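import Literature.Computability.FineGrained.SparsifierScan
import HarnessLib

/-!
# The sparsification algorithm as a stack program, IV: input, main loop, output

Family `fine-grained` (trunk T-CPLX-FINE), continuing `SparsifierScan.lean`. This file closes
the program implementing `Reduce` (Impagliazzo–Paturi–Zane, JCSS 63 (2001), §2) on the encoding
`KCNF.encode φ` of a k-CNF:

* `readHeader` — split the input into the header (`numVars` in binary and a comma, kept in
  `hdr2` for the output formulas) and the clause part;
* `normalize` — remove repeated literals inside each clause (keeping last occurrences, `ddl`),
  detect an empty clause (`kill`), and lay the root family on the work-list `wl`;
* `readFamily`, `nodeBody`, `mainLoop` — the depth-first traversal of the recursion tree of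
  `Reduce` driven by the work-list: read the top family, apply `Θ` (`Sparsifier.theta`), scan
  for a sunflower (`scan`), and either push the two children or emit the leaf formula
  (`emitLeaf`) on the reversed output `out2`;
* `main` — the whole program, ending with the output word on `out` and every other register
  empty, as `ACom.exists_computesInTime` requires;
* the list-level model of the traversal (`nodeKids`, `nodeLeaf`, `dfsOut`, `dfsDone`) and the
  `ACom.Runs` specification `runs_main` relative to it, with a step bound that is a polynomial
  in the size parameters times the number of iterations.

The identification of this model with `Sparsification.run` (hence the bounds on the number of
iterations and the correctness of the output) is the subject of the final file.

## References

* R. Impagliazzo, R. Paturi, F. Zane, *Which problems have strongly exponential complexity?*,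
  J. Comput. Syst. Sci. 63 (2001) 512–530, §2 (algorithm `Reduce`).
-/

namespace Literature.Computability.FineGrained.Sparsifier

open _root_.Computability Complexity Complexity.ACom

/-! ### The input word -/

/-- The header of the encoding of a k-CNF on `n` variables: `n` in binary, then a comma; it is
also the header of every output formula. [folklore] -/
def hdrW (n : ℕ) : List Γ' := (encodeNat n).map Γ'.bit ++ [Γ'.comma]

/-- The binary digits contain no comma. [folklore] -/
theorem comma_not_mem_bits (n : ℕ) : Γ'.comma ∉ (encodeNat n).map Γ'.bit := by simp

/-- `KCNF.encode` is the header followed by the family word of the clauses. [folklore] -/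
theorem encode_eq_hdr {k : ℕ} (φ : KCNF k) :
    φ.encode = (encodeNat φ.numVars).map Γ'.bit ++ Γ'.comma :: wFam φ.clauses := rfl

/-- `KCNF.encodeList` in terms of headers and family words. [folklore] -/
theorem encodeList_eq {k : ℕ} (l : List (KCNF k)) :
    KCNF.encodeList l = l.flatMap fun ψ => hdrW ψ.numVars ++ wFam ψ.clauses ++ [Γ'.blank] := by
  simp [KCNF.encodeList, encode_eq_hdr, hdrW, wFam]

/-! ### Reading the header -/

/-- Body of the header loop: copy the symbol to `hdr`; at the comma move the rest of the input
away (to `tmp`, reversed) so that the loop stops. [folklore] -/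
def readHdrBody (a : Γ') : Prog :=
  push K.hdr a ;; match a with
    | Γ'.comma => pour K.inp K.tmp
    | _ => skip

/-- `readHeader`: afterwards `hdr2` holds the header, `raw` the clause part, `inp` is empty.
[folklore] -/
def readHeader : Prog := loop K.inp readHdrBody ;; pour K.tmp K.raw ;; pour K.hdr K.hdr2

/-- The copying segment of the header loop over comma-free symbols. [folklore] -/
theorem segRuns_readHdr_bits : ∀ (bs : List Γ') (_ : Γ'.comma ∉ bs) (T : Store) (v : List Γ')
    (_ : T K.inp = bs ++ v),
    SegRuns K.inp readHdrBody bs T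
      (Function.update (Function.update T K.inp v) K.hdr (bs.reverse ++ T K.hdr)) (3 * bs.length)
  | [], _, T, v, h => by
    refine (SegRuns.nil K.inp readHdrBody T).of_eq ?_ (by simp)
    rw [List.nil_append] at h
    simp [← h]
  | a :: bs, hbs, T, v, h => by
    have ha : a ≠ Γ'.comma := fun e => hbs (e ▸ List.mem_cons_self)
    have hbs' : Γ'.comma ∉ bs := fun e => hbs (List.mem_cons_of_mem _ e)
    set T₁ : Store := Function.update (Function.update T K.inp (bs ++ v)) K.hdr (a :: T K.hdr)
      with hT₁
    have hbody : Runs (readHdrBody a) (Function.update T K.inp (bs ++ v)) T₁ 1 := by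
      have e1 := (Runs.push K.hdr a (Function.update T K.inp (bs ++ v))).seq (Runs.skip _)
      have e : (push K.hdr a ;; skip : Prog) = readHdrBody a := by
        cases a with
        | comma => exact absurd rfl ha
        | _ => rfl
      rw [e] at e1
      refine e1.of_eq ?_ (by norm_num)
      simp [hT₁]
    have ih := segRuns_readHdr_bits bs hbs' T₁ v (by simp [hT₁])
    refine (SegRuns.cons h hbody ih).of_eq ?_ (by simp; omega)
    simp only [hT₁]
    funext r; cases r <;> simp

/-- **Specification of `readHeader`.** [folklore] -/
theorem runs_readHeader (n : ℕ) (rest : List Γ') (T : Store)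
    (hinp : T K.inp = (encodeNat n).map Γ'.bit ++ Γ'.comma :: rest) (hhdr : T K.hdr = [])
    (htmp : T K.tmp = []) (hraw : T K.raw = []) (hhdr2 : T K.hdr2 = []) :
    Runs readHeader T (Function.update (Function.update (Function.update T K.inp []) K.raw rest)
      K.hdr2 (hdrW n)) (9 * (T K.inp).length + 8) := by
  unfold readHeader
  set bs := (encodeNat n).map Γ'.bit with hbs
  have hseg := segRuns_readHdr_bits bs (comma_not_mem_bits n) T (Γ'.comma :: rest) hinp
  rw [hhdr, List.append_nil] at hseg
  set T₁ : Store := Function.update (Function.update T K.inp (Γ'.comma :: rest)) K.hdr bs.reverse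
    with hT₁
  -- the comma: copy it and move the rest away
  have e1 := Runs.push K.hdr Γ'.comma (Function.update T₁ K.inp rest)
  set T₂ : Store := Function.update (Function.update T₁ K.inp rest) K.hdr (Γ'.comma :: bs.reverse)
    with hT₂
  have hT₂eq : Function.update (Function.update T₁ K.inp rest) K.hdr
      (Γ'.comma :: Function.update T₁ K.inp rest K.hdr) = T₂ := by
    simp [hT₂, hT₁]
  rw [hT₂eq] at e1
  have e2 := runs_pour (a := K.inp) (b := K.tmp) (by decide) T₂
  have hT₂inp : T₂ K.inp = rest := by simp [hT₂]
  have hT₂tmp : T₂ K.tmp = [] := by simp [hT₂, hT₁, htmp]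
  rw [hT₂inp, hT₂tmp, List.append_nil] at e2
  have hcomma : Runs (readHdrBody Γ'.comma) (Function.update T₁ K.inp rest)
      (Function.update (Function.update T₂ K.inp []) K.tmp rest.reverse) (1 + (3 * rest.length + 1)) :=
    e1.seq e2
  have hstep := SegRuns.single (f := readHdrBody) (by simp [hT₁] : T₁ K.inp = Γ'.comma :: rest) hcomma
  have hloop := (hseg.append hstep).runs_loop_nil (by simp)
  set T₃ : Store := Function.update (Function.update T₂ K.inp []) K.tmp rest.reverse with hT₃
  -- the clause part in reading order, the header in reading order
  have e3 := runs_pour (a := K.tmp) (b := K.raw) (by decide) T₃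
  have hT₃tmp : T₃ K.tmp = rest.reverse := by simp [hT₃]
  have hT₃raw : T₃ K.raw = [] := by simp [hT₃, hT₂, hT₁, hraw]
  rw [hT₃tmp, hT₃raw, List.length_reverse, List.reverse_reverse, List.append_nil] at e3
  set T₄ : Store := Function.update (Function.update T₃ K.tmp []) K.raw rest with hT₄
  have e4 := runs_pour (a := K.hdr) (b := K.hdr2) (by decide) T₄
  have hT₄hdr : T₄ K.hdr = Γ'.comma :: bs.reverse := by simp [hT₄, hT₃, hT₂]
  have hT₄hdr2 : T₄ K.hdr2 = [] := by simp [hT₄, hT₃, hT₂, hT₁, hhdr2]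
  rw [hT₄hdr, hT₄hdr2, List.append_nil] at e4
  have := hloop.seq (e3.seq e4)
  refine this.of_eq ?_ ?_
  · rw [hT₄, hT₃, hT₂, hT₁]
    funext r; cases r <;> simp [hhdr, htmp, hdrW, hbs]
  · rw [hinp]
    simp only [List.length_append, List.length_cons, List.length_reverse, hbs, List.length_map]
    omega

/-! ### Normalising the input clauses -/

/-- Remove repeated literals, keeping the *last* occurrence of each — the prefix `done` has been
decided against `rest`. [folklore] -/
def ddlAux : List Lit → List Lit → List Lit
  | [], _ => []
  | l :: d, rest => if l ∈ d ++ rest then ddlAux d rest else l :: ddlAux d rest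

/-- Remove repeated literals of a clause, keeping last occurrences. [folklore] -/
def ddl (c : List Lit) : List Lit := ddlAux c []

/-- One more literal decided. [folklore] -/
theorem ddlAux_append_singleton : ∀ (done : List Lit) (l : Lit) (rest : List Lit),
    ddlAux (done ++ [l]) rest = ddlAux done (l :: rest) ++ (if l ∈ rest then [] else [l])
  | [], l, rest => by simp [ddlAux]
  | a :: done, l, rest => by
    have e : (a ∈ (done ++ [l]) ++ rest) ↔ (a ∈ done ++ l :: rest) := by simp
    simp only [List.cons_append, ddlAux]
    rw [ddlAux_append_singleton done l rest]
    by_cases h : a ∈ done ++ l :: rest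
    · rw [if_pos (e.2 h), if_pos h]
    · rw [if_neg (fun h' => h (e.1 h')), if_neg h, List.cons_append]

/-- `ddlAux` with nothing decided. [folklore] -/
@[simp] theorem ddlAux_nil (rest : List Lit) : ddlAux [] rest = [] := rfl

/-- `ddl` yields a sub-list. [folklore] -/
theorem ddlAux_sublist : ∀ (d rest : List Lit), (ddlAux d rest).Sublist d
  | [], rest => by simp
  | l :: d, rest => by
    simp only [ddlAux]
    split
    · exact (ddlAux_sublist d rest).cons l
    · exact (ddlAux_sublist d rest).cons_cons l

/-- Members of `ddlAux d rest` are members of `d`. [folklore] -/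
theorem mem_of_mem_ddlAux {d rest : List Lit} {l : Lit} (h : l ∈ ddlAux d rest) : l ∈ d :=
  (ddlAux_sublist d rest).subset h

/-- `ddlAux d rest` has the members of `d` that do not occur in `rest`. [folklore] -/
theorem mem_ddlAux_iff : ∀ {d rest : List Lit} {l : Lit}, l ∈ ddlAux d rest ↔ l ∈ d ∧ l ∉ rest
  | [], rest, l => by simp
  | a :: d, rest, l => by
    simp only [ddlAux]
    split
    · rename_i h
      rw [mem_ddlAux_iff, List.mem_cons]
      constructor
      · rintro ⟨h1, h2⟩; exact ⟨Or.inr h1, h2⟩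
      · rintro ⟨rfl | h1, h2⟩
        · rw [List.mem_append] at h
          rcases h with h | h
          · exact ⟨h, h2⟩
          · exact absurd h h2
        · exact ⟨h1, h2⟩
    · rename_i h
      rw [List.mem_cons, mem_ddlAux_iff, List.mem_cons]
      rw [List.mem_append, not_or] at h
      constructor
      · rintro (rfl | ⟨h1, h2⟩)
        · exact ⟨Or.inl rfl, h.2⟩
        · exact ⟨Or.inr h1, h2⟩
      · rintro ⟨rfl | h1, h2⟩
        · exact Or.inl rfl
        · exact Or.inr ⟨h1, h2⟩

/-- `ddl c` has the same members as `c`. [folklore] -/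
theorem mem_ddl_iff {c : List Lit} {l : Lit} : l ∈ ddl c ↔ l ∈ c := by
  rw [ddl, mem_ddlAux_iff]; simp

/-- `ddlAux d rest` has no repetition. [folklore] -/
theorem nodup_ddlAux : ∀ (d rest : List Lit), (ddlAux d rest).Nodup
  | [], rest => List.nodup_nil
  | a :: d, rest => by
    simp only [ddlAux]
    split
    · exact nodup_ddlAux d rest
    · rename_i h
      rw [List.mem_append, not_or] at h
      exact List.nodup_cons.2 ⟨fun h' => h.1 (mem_of_mem_ddlAux h'), nodup_ddlAux d rest⟩

/-- `ddl c` has no repetition. [folklore] -/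
theorem nodup_ddl (c : List Lit) : (ddl c).Nodup := nodup_ddlAux c []

/-- `ddl` does not lengthen. [folklore] -/
theorem length_ddl_le (c : List Lit) : (ddl c).length ≤ c.length := (ddlAux_sublist c []).length_le

/-- `normClause`: with a clause body `cbody c₀` delivered reversed in `cacc`, append to `kid` the
reversed clause word of `ddl c₀` (reusing `petalLitAct`: a literal is dropped iff it occurs again
later in the clause). [folklore] -/
def normClause : Prog :=
  pour K.cacc K.c ;; push K.kid Γ'.bra ;; loop K.c (litPass K.kid K.x petalLitAct) ;;
  push K.kid Γ'.ket

/-- Cost of `normClause`. [folklore] -/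
def cNormC (L kk : ℕ) : ℕ := 3 * ((L + 1) * kk) + (36 * (L + 1) * kk + 8 * L + 15) * kk + 4

/-- **Specification of `normClause`.** [folklore] -/
theorem runs_normClause (c₀ : List Lit) (L kk : ℕ) (hL : ∀ l ∈ c₀, (litBody l).length ≤ L)
    (hk : c₀.length ≤ kk) (T : Store) (hcacc : T K.cacc = (cbody c₀).reverse) (hc : T K.c = [])
    (hT : Clean T) :
    Runs normClause T (Function.update (Function.update T K.cacc []) K.kid
      ((Γ'.bra :: cbody (ddl c₀) ++ [Γ'.ket]).reverse ++ T K.kid)) (cNormC L kk) := by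
  obtain ⟨hx, hx2, hy, hne, hfl, hfl2, hc2, hd2⟩ := hT
  unfold normClause
  set W := (L + 1) * kk with hW
  have hWc : (cbody c₀).length ≤ W :=
    (length_cbody_le hL).trans (by rw [hW]; exact Nat.mul_le_mul_left _ hk)
  have e1 := runs_pour (a := K.cacc) (b := K.c) (by decide) T
  rw [hcacc, hc, List.length_reverse, List.reverse_reverse, List.append_nil] at e1
  set T₁ := Function.update (Function.update T K.cacc []) K.c (cbody c₀) with hT₁
  have e2 := Runs.push K.kid Γ'.bra T₁
  set T₂ := Function.update T₁ K.kid (Γ'.bra :: T₁ K.kid) with hT₂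
  have hT₂v : ∀ r, r ≠ K.cacc → r ≠ K.c → r ≠ K.kid → T₂ r = T r := by
    intro r h1 h2 h3
    simp [hT₂, hT₁, Function.update_of_ne h1, Function.update_of_ne h2, Function.update_of_ne h3]
  -- the filtering pass over the clause itself
  set St : List Lit → List Lit → Store := fun done rest =>
    Function.update (Function.update T₂ K.c (cbody rest)) K.kid
      ((cbody (ddlAux done rest)).reverse ++ Γ'.bra :: T K.kid) with hSt
  have hpass := runs_litPass (reg := K.c) (sv := K.kid) (ac := K.x) petalLitAct (by decide)
    (by decide) (by decide) St c₀ L (36 * (L + 1) * kk + 4 * L + 12)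
    (fun done rest => by simp [hSt])
    (fun done rest => by
      simp only [hSt]
      rw [Function.update_of_ne (by decide), Function.update_of_ne (by decide),
        hT₂v K.x (by decide) (by decide) (by decide), hx])
    (fun done l rest hfull hl => by
      have hrest : ∀ l' ∈ rest, (litBody l').length ≤ L := fun l' h =>
        hL l' (by rw [← hfull]; simp [h])
      have hkr : rest.length ≤ kk := by
        have : rest.length ≤ c₀.length := by rw [← hfull]; simp; omega
        exact this.trans hk
      unfold petalLitAct
      set P := litPre K.c K.kid K.x (St done (l :: rest)) l rest with hP
      have hPv : ∀ r, r ≠ K.cacc → r ≠ K.c → r ≠ K.kid → r ≠ K.x → P r = T r := by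
        intro r h1 h2 h3 h4
        rw [hP, litPre, Function.update_of_ne h4, Function.update_of_ne h3,
          Function.update_of_ne h2, hSt]
        simp only []
        rw [Function.update_of_ne h3, Function.update_of_ne h2, hT₂v r h1 h2 h3]
      have hPc : P K.c = cbody rest := by simp [hP, litPre]
      have hPx : P K.x = (litBody l).reverse := by
        simp only [hP, litPre]
        rw [Function.update_self]
        simp only [hSt]
        rw [Function.update_of_ne (by decide), Function.update_of_ne (by decide),
          hT₂v K.x (by decide) (by decide) (by decide), hx, List.append_nil]
      have hPkid : P K.kid = (litBody l ++ [Γ'.comma]).reverse ++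
          ((cbody (ddlAux done (l :: rest))).reverse ++ Γ'.bra :: T K.kid) := by
        simp [hP, litPre, hSt]
      have f1 := runs_memXC l rest L hl hrest P hPc hPx
        (by rw [hPv K.c2 (by decide) (by decide) (by decide) (by decide), hc2])
        (by rw [hPv K.y (by decide) (by decide) (by decide) (by decide), hy])
        (by rw [hPv K.x2 (by decide) (by decide) (by decide) (by decide), hx2])
        (by rw [hPv K.ne (by decide) (by decide) (by decide) (by decide), hne])
        (by rw [hPv K.fl (by decide) (by decide) (by decide) (by decide), hfl])
      have hPfl : P K.fl = [] := by rw [hPv K.fl (by decide) (by decide) (by decide) (by decide), hfl]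
      set P₁ := Function.update P K.fl (flag (l ∈ rest)) with hP₁
      have hq : Function.update P₁ K.fl [] = P := by
        rw [hP₁, Function.update_idem, ← hPfl, Function.update_eq_self]
      have hTx : T₂ K.x = [] := by rw [hT₂v K.x (by decide) (by decide) (by decide), hx]
      have f2 : Runs (pop K.fl fun o => match o with
          | some _ => dropLit
          | none => clear K.x) P₁ (St (done ++ [l]) rest) (4 * L + 5) := by
        by_cases hlr : l ∈ rest
        · have hk' : P₁ K.fl = [Γ'.blank] := by simp [hP₁, flag, hlr]
          have g := runs_dropLit P (litBody l).reverse ((litBody l ++ [Γ'.comma]).reverse)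
            ((cbody (ddlAux done (l :: rest))).reverse ++ Γ'.bra :: T K.kid) hPx hPkid (by simp)
          rw [List.length_reverse, ← hq] at g
          refine (Runs.pop_cons hk' (g.of_eq ?_ le_rfl)).mono (by omega)
          rw [hq, hP]
          simp only [litPre, hSt, ddlAux_append_singleton, if_pos hlr, List.append_nil]
          funext r; cases r <;> simp [hTx]
        · have hk' : P₁ K.fl = [] := by simp [hP₁, flag, hlr]
          have hq' : P₁ = P := by rw [← hq, ← hk', Function.update_eq_self]
          rw [hq']
          have g := runs_clear K.x P
          rw [hPx, List.length_reverse] at g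
          refine (Runs.pop_nil hPfl g).of_eq ?_ (by omega)
          rw [hP]
          simp only [litPre, hSt, ddlAux_append_singleton, if_neg hlr, cbody_append]
          funext r; cases r <;> simp [hTx, cbody_cons]
      have := f1.seq f2
      refine this.mono ?_
      have : 36 * (L + 1) * rest.length ≤ 36 * (L + 1) * kk := Nat.mul_le_mul_left _ hkr
      omega)
    c₀ [] rfl hL
  have hSt0 : St [] c₀ = T₂ := by
    funext r; cases r <;> simp [hSt, hT₂, hT₁]
  rw [hSt0, List.nil_append] at hpass
  set T₃ := St c₀ [] with hT₃
  have e4 := Runs.push K.kid Γ'.ket T₃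
  have := e1.seq (e2.seq (hpass.seq e4))
  refine this.of_eq ?_ ?_
  · rw [hT₃]
    simp only [hSt, hT₂, hT₁, ddl]
    funext r; cases r <;> simp [hc]
  · simp only [cNormC, ← hW]
    have : (4 * L + (36 * (L + 1) * kk + 4 * L + 12) + 3) * c₀.length ≤
        (36 * (L + 1) * kk + 8 * L + 15) * kk := by
      rw [show 4 * L + (36 * (L + 1) * kk + 4 * L + 12) + 3 = 36 * (L + 1) * kk + 8 * L + 15 by ring]
      exact Nat.mul_le_mul_left _ hk
    omega

/-- Action of the normalisation pass on a clause: record an empty clause on `kill`, then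
normalise the clause onto `kid`. [folklore] -/
def normAct : Prog :=
  ifTop K.cacc (fun o => match o with
    | none => push K.kill Γ'.blank
    | some _ => skip) ;; normClause

/-- `normalize`: with the clause part of the input in `raw`, lay the normalised root family on the
work-list (`wl := wWL [clauses.map ddl]`) and count the empty clauses on `kill`. [folklore] -/
def normalize : Prog :=
  loop K.raw (famPass K.j1 K.cacc normAct) ;; clear K.j1 ;; push K.kid Γ'.blank ;; pour K.kid K.wl

/-- Cost of `normalize` over `m` clauses. [folklore] -/
def cNorm (L kk m : ℕ) : ℕ :=
  (4 * ((L + 1) * kk) + (cNormC L kk + 4) + 6) * m + 2 * (((L + 1) * kk + 2) * m) +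
    3 * (((L + 1) * kk + 2) * m + 1) + 5

/-- **Specification of `normalize`.** [folklore] -/
theorem runs_normalize (Cl : List (List Lit)) (L kk : ℕ)
    (hL : ∀ c ∈ Cl, ∀ l ∈ c, (litBody l).length ≤ L) (hk : ∀ c ∈ Cl, c.length ≤ kk) (T : Store)
    (hraw : T K.raw = wFam Cl) (hj1 : T K.j1 = []) (hcacc : T K.cacc = []) (hc : T K.c = [])
    (hkid : T K.kid = []) (hkill : T K.kill = []) (hwl : T K.wl = []) (hT : Clean T) :
    Runs normalize T (Function.update (Function.update (Function.update T K.raw []) K.kill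
      (unary (Cl.count []))) K.wl (wWL [Cl.map ddl])) (cNorm L kk Cl.length) := by
  unfold normalize
  set W := (L + 1) * kk with hW
  have hWC : ∀ c ∈ Cl, (cbody c).length ≤ W := fun c hc' =>
    (length_cbody_le (hL c hc')).trans (by rw [hW]; exact Nat.mul_le_mul_left _ (hk c hc'))
  have hWd : ∀ c ∈ Cl, (cbody (ddl c)).length ≤ W := fun c hc' =>
    (length_cbody_le_of_sublist (ddlAux_sublist c [])).trans (hWC c hc')
  have hlen : (wFam Cl).length ≤ (W + 2) * Cl.length := length_wFam_le hWC
  set St : List (List Lit) → List (List Lit) → Store := fun done rest =>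
    Function.update (Function.update (Function.update (Function.update T K.raw (wFam rest)) K.j1
      (wFam done).reverse) K.kid (wFam (done.map ddl)).reverse) K.kill (unary (done.count [])) with hSt
  have hpass := runs_famPass (reg := K.raw) (sv := K.j1) (ca := K.cacc) normAct (by decide)
    (by decide) (by decide) St Cl W (cNormC L kk + 4)
    (fun done rest => by simp [hSt])
    (fun done rest => by simp [hSt, hcacc])
    (fun done c₀ rest hfull hcW => by
      have hcmem : c₀ ∈ Cl := by rw [← hfull]; simp
      unfold normAct
      set P := famPre K.raw K.j1 K.cacc (St done (c₀ :: rest)) c₀ rest with hP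
      have hPcacc : P K.cacc = (cbody c₀).reverse := by simp [hP, famPre, hSt, hcacc]
      have hPcl : Clean P := ⟨by simp [hP, famPre, hSt, hT.x], by simp [hP, famPre, hSt, hT.x2],
        by simp [hP, famPre, hSt, hT.y], by simp [hP, famPre, hSt, hT.ne],
        by simp [hP, famPre, hSt, hT.fl], by simp [hP, famPre, hSt, hT.fl2],
        by simp [hP, famPre, hSt, hT.c2], by simp [hP, famPre, hSt, hT.d2]⟩
      set P₁ := Function.update P K.kill ((if c₀ = [] then [Γ'.blank] else []) ++ P K.kill) with hP₁
      have e1 : Runs (ifTop K.cacc fun o => match o with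
          | none => push K.kill Γ'.blank
          | some _ => skip) P P₁ 3 := by
        cases hc0 : c₀ with
        | nil =>
          have hk : P K.cacc = [] := by rw [hPcacc, hc0]; rfl
          refine (Runs.ifTop_nil hk (Runs.push' ?_)).mono (by norm_num)
          rw [hP₁, if_pos hc0]; rfl
        | cons l c' =>
          obtain ⟨a, w, hw⟩ : ∃ a w, P K.cacc = a :: w := by
            rw [hPcacc, hc0, cbody_cons]
            cases h : (litBody l ++ Γ'.comma :: cbody c').reverse with
            | nil => simp at h
            | cons a w => exact ⟨a, w, rfl⟩
          refine (Runs.ifTop_cons hw ((Runs.skip _).of_eq ?_ le_rfl)).mono (by norm_num)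
          rw [hP₁, if_neg (by rw [hc0]; exact List.cons_ne_nil _ _), List.nil_append,
            Function.update_eq_self]
      have e2 := runs_normClause c₀ L kk (hL c₀ hcmem) (hk c₀ hcmem) P₁ (by simp [hP₁, hPcacc])
        (by simp [hP₁, hP, famPre, hSt, hc]) (hPcl.of_update _ _ (by decide))
      refine (e1.seq e2).of_eq ?_ (by omega)
      rw [hP₁, hP]
      simp only [famPre, hSt, List.map_append, List.map_cons, List.map_nil, wFam_append,
        wFam_cons, wFam_nil, List.count_append]
      by_cases hc0 : c₀ = []
      · subst hc0
        funext r; cases r <;> simp [hcacc, unary_succ]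
      · have : List.count [] [c₀] = 0 := by simp [hc0]
        funext r; cases r <;> simp [hcacc, hc0, this])
    Cl [] rfl hWC
  have hSt0 : St [] Cl = T := by
    funext r; cases r <;> simp [hSt, hraw, hj1, hkid, hkill]
  rw [hSt0, List.nil_append] at hpass
  set T₁ := St Cl [] with hT₁
  have e3 := runs_clear K.j1 T₁
  have hT₁j1 : T₁ K.j1 = (wFam Cl).reverse := by simp [hT₁, hSt]
  rw [hT₁j1, List.length_reverse] at e3
  set T₂ := Function.update T₁ K.j1 [] with hT₂
  have e4 := Runs.push K.kid Γ'.blank T₂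
  set T₃ := Function.update T₂ K.kid (Γ'.blank :: T₂ K.kid) with hT₃
  have e5 := runs_pour (a := K.kid) (b := K.wl) (by decide) T₃
  have hT₃kid : T₃ K.kid = (wWL [Cl.map ddl]).reverse := by
    simp [hT₃, hT₂, hT₁, hSt, wWL_cons]
  have hT₃wl : T₃ K.wl = [] := by simp [hT₃, hT₂, hT₁, hSt, hwl]
  rw [hT₃kid, hT₃wl, List.length_reverse, List.reverse_reverse, List.append_nil] at e5
  have := hpass.seq (e3.seq (e4.seq e5))
  refine this.of_eq ?_ ?_
  · rw [hT₃, hT₂, hT₁]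
    simp only [hSt]
    funext r; cases r <;> simp [hj1, hkid]
  · have hlen2 : (wWL [Cl.map ddl]).length ≤ (W + 2) * Cl.length + 1 := by
      rw [wWL_cons, wWL_nil, List.length_append, List.length_singleton]
      have := length_wFam_le (F := Cl.map ddl) (W := W) (by
        intro c hc'
        obtain ⟨c', hc'mem, rfl⟩ := List.mem_map.1 hc'
        exact hWd c' hc'mem)
      rw [List.length_map] at this
      omega
    simp only [cNorm, ← hW]
    omega

/-! ### Reading the top family of the work-list -/

/-- Body of the family-reading loop: copy the symbol to `tmp`; at the blank closing the family,
move the rest of the work-list away (to `wl2`, reversed) so that the loop stops. [folklore] -/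
def readFamBody (b : Γ') : Prog :=
  match b with
  | Γ'.blank => pour K.wl K.wl2
  | _ => push K.tmp b

/-- `readFamily`: called after the opening bracket of the top family has been popped from `wl`;
afterwards `cur` holds the family word and `wl` the rest of the work-list. [folklore] -/
def readFamily : Prog :=
  push K.tmp Γ'.bra ;; loop K.wl readFamBody ;; pour K.wl2 K.wl ;; pour K.tmp K.cur

/-- The copying segment of the family-reading loop over blank-free symbols. [folklore] -/
theorem segRuns_readFam_body : ∀ (bs : List Γ') (_ : Γ'.blank ∉ bs) (T : Store) (v : List Γ')
    (_ : T K.wl = bs ++ v),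
    SegRuns K.wl readFamBody bs T
      (Function.update (Function.update T K.wl v) K.tmp (bs.reverse ++ T K.tmp)) (3 * bs.length)
  | [], _, T, v, h => by
    refine (SegRuns.nil K.wl readFamBody T).of_eq ?_ (by simp)
    rw [List.nil_append] at h
    simp [← h]
  | a :: bs, hbs, T, v, h => by
    have ha : a ≠ Γ'.blank := fun e => hbs (e ▸ List.mem_cons_self)
    have hbs' : Γ'.blank ∉ bs := fun e => hbs (List.mem_cons_of_mem _ e)
    set T₁ : Store := Function.update (Function.update T K.wl (bs ++ v)) K.tmp (a :: T K.tmp)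
      with hT₁
    have hbody : Runs (readFamBody a) (Function.update T K.wl (bs ++ v)) T₁ 1 := by
      have e1 := Runs.push K.tmp a (Function.update T K.wl (bs ++ v))
      have e : (push K.tmp a : Prog) = readFamBody a := by
        cases a with
        | blank => exact absurd rfl ha
        | _ => rfl
      rw [e] at e1
      refine e1.of_eq ?_ le_rfl
      simp [hT₁]
    have ih := segRuns_readFam_body bs hbs' T₁ v (by simp [hT₁])
    refine (SegRuns.cons h hbody ih).of_eq ?_ (by simp; omega)
    simp only [hT₁]
    funext r; cases r <;> simp

/-- The tail of the word of a nonempty family contains no blank. [folklore] -/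
theorem blank_not_mem_tail_wFam (F : List (List Lit)) : Γ'.blank ∉ (wFam F).tail := fun h =>
  blank_not_mem_wFam F (List.mem_of_mem_tail h)

/-- Words of work-lists concatenate. [folklore] -/
theorem wWL_append (L₁ L₂ : List (List (List Lit))) : wWL (L₁ ++ L₂) = wWL L₁ ++ wWL L₂ := by
  simp [wWL]

/-- **Specification of `readFamily`.** [folklore] -/
theorem runs_readFamily (F : List (List Lit)) (hF : F ≠ []) (Lw : List (List (List Lit)))
    (T : Store) (hwl : T K.wl = (wFam F).tail ++ Γ'.blank :: wWL Lw) (htmp : T K.tmp = [])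
    (hwl2 : T K.wl2 = []) (hcur : T K.cur = []) :
    Runs readFamily T (Function.update (Function.update T K.wl (wWL Lw)) K.cur (wFam F))
      (6 * ((wFam F).length + (wWL Lw).length) + 8) := by
  unfold readFamily
  obtain ⟨c, F', rfl⟩ := List.exists_cons_of_ne_nil hF
  have htail : (wFam (c :: F')).tail = cbody c ++ Γ'.ket :: wFam F' := by simp [wFam_cons]
  have e1 := Runs.push K.tmp Γ'.bra T
  rw [htmp] at e1
  set T₁ := Function.update T K.tmp [Γ'.bra] with hT₁
  have hseg := segRuns_readFam_body (wFam (c :: F')).tail (blank_not_mem_tail_wFam _) T₁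
    (Γ'.blank :: wWL Lw) (by simp [hT₁, hwl])
  set T₂ := Function.update (Function.update T₁ K.wl (Γ'.blank :: wWL Lw)) K.tmp
    ((wFam (c :: F')).tail.reverse ++ T₁ K.tmp) with hT₂
  have hblank : Runs (readFamBody Γ'.blank) (Function.update T₂ K.wl (wWL Lw))
      (Function.update (Function.update T₂ K.wl []) K.wl2 (wWL Lw).reverse) (3 * (wWL Lw).length + 1) := by
    have := runs_pour (a := K.wl) (b := K.wl2) (by decide) (Function.update T₂ K.wl (wWL Lw))
    simp only [Function.update_self, Function.update_idem] at this
    refine this.of_eq ?_ le_rfl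
    simp [hT₂, hT₁, hwl2]
  have hstep := SegRuns.single (f := readFamBody) (by simp [hT₂] : T₂ K.wl = Γ'.blank :: wWL Lw) hblank
  have hloop := (hseg.append hstep).runs_loop_nil (by simp)
  set T₃ := Function.update (Function.update T₂ K.wl []) K.wl2 (wWL Lw).reverse with hT₃
  have e3 := runs_pour (a := K.wl2) (b := K.wl) (by decide) T₃
  have hT₃wl2 : T₃ K.wl2 = (wWL Lw).reverse := by simp [hT₃]
  have hT₃wl : T₃ K.wl = [] := by simp [hT₃]
  rw [hT₃wl2, hT₃wl, List.length_reverse, List.reverse_reverse, List.append_nil] at e3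
  set T₄ := Function.update (Function.update T₃ K.wl2 []) K.wl (wWL Lw) with hT₄
  have e4 := runs_pour (a := K.tmp) (b := K.cur) (by decide) T₄
  have hT₄tmp : T₄ K.tmp = (wFam (c :: F')).reverse := by
    simp [hT₄, hT₃, hT₂, hT₁, wFam_cons]
  have hT₄cur : T₄ K.cur = [] := by simp [hT₄, hT₃, hT₂, hT₁, hcur]
  rw [hT₄tmp, hT₄cur, List.length_reverse, List.reverse_reverse, List.append_nil] at e4
  have := e1.seq (hloop.seq (e3.seq e4))
  refine this.of_eq ?_ ?_
  · rw [hT₄, hT₃, hT₂, hT₁]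
    funext r; cases r <;> simp [htmp, hwl2]
  · have : (wFam (c :: F')).tail.length + 1 = (wFam (c :: F')).length := by simp [wFam_cons]
    omega

/-! ### One node of the traversal -/

/-- The children pushed at a node with family `F` (heart child first), according to the list
models of `Θ` and of the scan. [cite: ImpagliazzoPaturiZaneJCSS2001, §2 (line 5 of Reduce)] -/
def nodeKids (θ : ℕ → ℕ) (k : ℕ) (F : List (List Lit)) : List (List (List Lit)) :=
  match findBranch θ (thetaL F) (levels k) with
  | some (j, H) => [thetaL F ++ [H], thetaL F ++ petalsL j H (thetaL F)]
  | none => []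

/-- The leaf family emitted at a node with family `F`, if it is a leaf.
[cite: ImpagliazzoPaturiZaneJCSS2001, §2 (line 5 of Reduce, the output)] -/
def nodeLeaf (θ : ℕ → ℕ) (k : ℕ) (F : List (List Lit)) : Option (List (List Lit)) :=
  match findBranch θ (thetaL F) (levels k) with
  | some _ => none
  | none => some (thetaL F)

/-- The encoding of a leaf formula: header, family word, closing blank. [folklore] -/
def leafW (hd : List Γ') (M : List (List Lit)) : List Γ' := hd ++ wFam M ++ [Γ'.blank]

/-- The output emitted at a node. [folklore] -/
def nodeOut (θ : ℕ → ℕ) (k : ℕ) (hd : List Γ') (F : List (List Lit)) : List Γ' :=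
  match nodeLeaf θ k F with
  | some M => leafW hd M
  | none => []

/-- Nothing is found in the empty family. [folklore] -/
theorem findBranch_nil (θ : ℕ → ℕ) : ∀ ls : List (ℕ × ℕ), findBranch θ [] ls = none
  | [] => rfl
  | (j, i) :: ls => by
    rw [findBranch, show findLevel θ [] j i = none from rfl]
    exact findBranch_nil θ ls

/-- `Θ` of the empty family. [folklore] -/
@[simp] theorem thetaL_nil : thetaL [] = [] := rfl

/-- Body of the main loop on the first symbol `a` of the work-list: a blank is an empty family
(a leaf); otherwise read the family, apply `Θ`, scan, and push the children or emit the leaf.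
[cite: ImpagliazzoPaturiZaneJCSS2001, §2 (Reduce)] -/
def nodeBody (θ : ℕ → ℕ) (k : ℕ) (a : Γ') : Prog :=
  match a with
  | Γ'.blank => emitLeaf
  | _ => readFamily ;; theta ;; scan θ k ;;
      pop K.found fun o => match o with
        | some _ => clear K.acc
        | none => emitLeaf

/-- Between iterations of the main loop only the reversed output `out2`, the header `hdr2` and
the work-list `wl` are in use. [folklore] -/
def Idle (T : Store) : Prop := ∀ r, r ≠ K.out2 → r ≠ K.hdr2 → r ≠ K.wl → T r = []

/-- `Idle` survives updates of the three live registers. [folklore] -/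
theorem Idle.update {T : Store} (h : Idle T) {r : K} (hr : r = K.out2 ∨ r = K.hdr2 ∨ r = K.wl)
    (v : List Γ') : Idle (Function.update T r v) := by
  intro r' h1 h2 h3
  have : r' ≠ r := by rintro rfl; rcases hr with rfl | rfl | rfl <;> contradiction
  rw [Function.update_of_ne this]; exact h r' h1 h2 h3

/-- Cost of one node: `n` bounds the family, `wlen` the work-list word, `hdl` the header.
[folklore] -/
def cNode (L kk n th hdl wlen : ℕ) : ℕ :=
  6 * (((L + 1) * kk + 2) * n + wlen) + cTheta L kk n + cScan L kk n th +
    7 * hdl + 5 * (((L + 1) * kk + 2) * n) + 20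

/-- **One node, nonempty family.** [cite: ImpagliazzoPaturiZaneJCSS2001, §2 (Reduce)] -/
theorem runs_nodeBody_cons (θ : ℕ → ℕ) (k : ℕ) (F : List (List Lit)) (hF : F ≠ [])
    (Lw : List (List (List Lit))) (L kk th : ℕ) (hk : k ≤ kk) (hth : ∀ i, i < k → θ i ≤ th)
    (hLF : ∀ c ∈ F, ∀ l ∈ c, (litBody l).length ≤ L) (hkF : ∀ c ∈ F, c.length ≤ kk)
    (T : Store) (hT : Idle T) (hwl : T K.wl = (wFam F).tail ++ Γ'.blank :: wWL Lw) (a : Γ')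
    (ha : a ≠ Γ'.blank) :
    Runs (nodeBody θ k a) T (Function.update (Function.update T K.wl (wWL (nodeKids θ k F ++ Lw)))
      K.out2 ((nodeOut θ k (T K.hdr2) F).reverse ++ T K.out2))
      (cNode L kk F.length th (T K.hdr2).length (wWL Lw).length) := by
  have hI : ∀ r, r ≠ K.out2 → r ≠ K.hdr2 → r ≠ K.wl → T r = [] := hT
  set W := (L + 1) * kk with hW
  have hWF : ∀ c ∈ F, (cbody c).length ≤ W := fun c hc' =>
    (length_cbody_le (hLF c hc')).trans (by rw [hW]; exact Nat.mul_le_mul_left _ (hkF c hc'))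
  have hlenF : (wFam F).length ≤ (W + 2) * F.length := length_wFam_le hWF
  set M := thetaL F with hM
  have hMmem : ∀ c ∈ M, c ∈ F := fun c hc => mem_of_mem_thetaL hc
  have hLM : ∀ c ∈ M, ∀ l ∈ c, (litBody l).length ≤ L := fun c hc => hLF c (hMmem c hc)
  have hkM : ∀ c ∈ M, c.length ≤ kk := fun c hc => hkF c (hMmem c hc)
  have hMlen : M.length ≤ F.length := by
    have := length_foldl_thetaStep_le F []
    rw [hM, thetaL]; simpa using this
  have hWM : ∀ c ∈ M, (cbody c).length ≤ W := fun c hc => hWF c (hMmem c hc)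
  have hlenM : (wFam M).length ≤ (W + 2) * F.length :=
    (length_wFam_le hWM).trans (Nat.mul_le_mul_left _ hMlen)
  have hprog : nodeBody θ k a = (readFamily ;; theta ;; scan θ k ;;
      pop K.found fun o => match o with
        | some _ => clear K.acc
        | none => emitLeaf) := by
    cases a with
    | blank => exact absurd rfl ha
    | _ => rfl
  rw [hprog]
  -- read the family
  have e1 := runs_readFamily F hF Lw T hwl (hI _ (by decide) (by decide) (by decide))
    (hI _ (by decide) (by decide) (by decide)) (hI _ (by decide) (by decide) (by decide))
  set T₁ := Function.update (Function.update T K.wl (wWL Lw)) K.cur (wFam F) with hT₁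
  have hT₁v : ∀ r, r ≠ K.wl → r ≠ K.cur → T₁ r = T r := fun r h1 h2 => by
    simp [hT₁, Function.update_of_ne h1, Function.update_of_ne h2]
  have hT₁z : ∀ r, r ≠ K.out2 → r ≠ K.hdr2 → r ≠ K.wl → r ≠ K.cur → T₁ r = [] := fun r h0 h1 h2 h3 => by
    rw [hT₁v r h2 h3]; exact hI r h0 h1 h2
  -- Θ
  have e2 := runs_theta F L kk hLF hkF T₁ (by simp [hT₁])
    ⟨hT₁z _ (by decide) (by decide) (by decide) (by decide), hT₁z _ (by decide) (by decide) (by decide) (by decide),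
      hT₁z _ (by decide) (by decide) (by decide) (by decide), hT₁z _ (by decide) (by decide) (by decide) (by decide),
      hT₁z _ (by decide) (by decide) (by decide) (by decide), hT₁z _ (by decide) (by decide) (by decide) (by decide),
      hT₁z _ (by decide) (by decide) (by decide) (by decide), hT₁z _ (by decide) (by decide) (by decide) (by decide)⟩
    ⟨hT₁z _ (by decide) (by decide) (by decide) (by decide), hT₁z _ (by decide) (by decide) (by decide) (by decide),
      hT₁z _ (by decide) (by decide) (by decide) (by decide), hT₁z _ (by decide) (by decide) (by decide) (by decide),
      hT₁z _ (by decide) (by decide) (by decide) (by decide), hT₁z _ (by decide) (by decide) (by decide) (by decide),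
      hT₁z _ (by decide) (by decide) (by decide) (by decide), hT₁z _ (by decide) (by decide) (by decide) (by decide),
      hT₁z _ (by decide) (by decide) (by decide) (by decide), hT₁z _ (by decide) (by decide) (by decide) (by decide),
      hT₁z _ (by decide) (by decide) (by decide) (by decide), hT₁z _ (by decide) (by decide) (by decide) (by decide)⟩
  set T₂ := Function.update (Function.update T₁ K.cur []) K.acc (wFam M) with hT₂
  have hT₂z : ∀ r, r ≠ K.out2 → r ≠ K.hdr2 → r ≠ K.wl → r ≠ K.acc → T₂ r = [] := fun r h0 h1 h2 h3 => by
    rcases eq_or_ne r K.cur with rfl | h4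
    · simp [hT₂]
    · simp only [hT₂]; rw [Function.update_of_ne h3, Function.update_of_ne h4]; exact hT₁z r h0 h1 h2 h4
  -- the scan
  have e3 := runs_scan θ k M L kk th hk hth hLM hkM T₂ (by simp [hT₂])
    (hT₂z _ (by decide) (by decide) (by decide) (by decide))
    ⟨hT₂z _ (by decide) (by decide) (by decide) (by decide), hT₂z _ (by decide) (by decide) (by decide) (by decide),
      hT₂z _ (by decide) (by decide) (by decide) (by decide), hT₂z _ (by decide) (by decide) (by decide) (by decide),
      hT₂z _ (by decide) (by decide) (by decide) (by decide), hT₂z _ (by decide) (by decide) (by decide) (by decide),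
      hT₂z _ (by decide) (by decide) (by decide) (by decide), hT₂z _ (by decide) (by decide) (by decide) (by decide)⟩
    ⟨hT₂z _ (by decide) (by decide) (by decide) (by decide), hT₂z _ (by decide) (by decide) (by decide) (by decide),
      hT₂z _ (by decide) (by decide) (by decide) (by decide), hT₂z _ (by decide) (by decide) (by decide) (by decide),
      hT₂z _ (by decide) (by decide) (by decide) (by decide), hT₂z _ (by decide) (by decide) (by decide) (by decide),
      hT₂z _ (by decide) (by decide) (by decide) (by decide), hT₂z _ (by decide) (by decide) (by decide) (by decide),
      hT₂z _ (by decide) (by decide) (by decide) (by decide), hT₂z _ (by decide) (by decide) (by decide) (by decide),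
      hT₂z _ (by decide) (by decide) (by decide) (by decide), hT₂z _ (by decide) (by decide) (by decide) (by decide),
      hT₂z _ (by decide) (by decide) (by decide) (by decide), hT₂z _ (by decide) (by decide) (by decide) (by decide),
      hT₂z _ (by decide) (by decide) (by decide) (by decide), hT₂z _ (by decide) (by decide) (by decide) (by decide),
      hT₂z _ (by decide) (by decide) (by decide) (by decide)⟩
  set T₃ := afterBranch M T₂ (findBranch θ M (levels k)) with hT₃
  -- children or leaf
  set T₄ : Store := Function.update (Function.update T K.wl (wWL (nodeKids θ k F ++ Lw))) K.out2
    ((nodeOut θ k (T K.hdr2) F).reverse ++ T K.out2) with hT₄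
  have e4 : Runs (pop K.found fun o => match o with
      | some _ => clear K.acc
      | none => emitLeaf) T₃ T₄ (7 * (T K.hdr2).length + 5 * ((W + 2) * F.length) + 6) := by
    cases hfb : findBranch θ M (levels k) with
    | some p =>
      obtain ⟨j, H⟩ := p
      have hk' : T₃ K.found = [Γ'.blank] := by simp [hT₃, hfb, afterBranch, afterFind]
      have g := runs_clear K.acc (Function.update T₃ K.found [])
      have hv : Function.update T₃ K.found [] K.acc = wFam M := by
        simp [hT₃, hfb, afterBranch, afterFind, hT₂]
      rw [hv] at g
      refine (Runs.pop_cons hk' (g.of_eq ?_ le_rfl)).mono (by omega)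
      rw [hT₄, nodeKids, nodeOut, nodeLeaf, ← hM, hfb, hT₃, hfb]
      simp only [afterBranch, afterFind, hT₂, hT₁, List.reverse_nil, List.nil_append, wWL_append]
      funext r; cases r <;> simp [hI]
    | none =>
      have hk' : T₃ K.found = [] := by
        simp only [hT₃, hfb, afterBranch]; exact hT₂z _ (by decide) (by decide) (by decide) (by decide)
      have g := runs_emitLeaf T₃ (by
        simp only [hT₃, hfb, afterBranch]; exact hT₂z _ (by decide) (by decide) (by decide) (by decide))
      have hv1 : T₃ K.hdr2 = T K.hdr2 := by simp [hT₃, hfb, afterBranch, hT₂, hT₁]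
      have hv2 : T₃ K.acc = wFam M := by simp [hT₃, hfb, afterBranch, hT₂]
      rw [hv1, hv2] at g
      refine (Runs.pop_nil hk' (g.of_eq ?_ le_rfl)).mono (by omega)
      rw [hT₄, nodeKids, nodeOut, nodeLeaf, ← hM, hfb, hT₃, hfb]
      simp only [afterBranch, hT₂, hT₁, List.nil_append, leafW]
      funext r; cases r <;> simp [hI]
  have := e1.seq (e2.seq (e3.seq e4))
  refine this.of_eq rfl ?_
  have h1 : cTheta L kk F.length ≤ cTheta L kk F.length := le_rfl
  have h2 : cScan L kk M.length th ≤ cScan L kk F.length th := by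
    unfold cScan cLevel cProcS cTry cCount cKids cPetal cHeart cExtract
    gcongr
  simp only [cNode, ← hW]
  omega

/-- **One node, empty family** (a leaf with no clauses). [folklore] -/
theorem runs_nodeBody_nil (θ : ℕ → ℕ) (k : ℕ) (T : Store) (hT : Idle T) :
    Runs (nodeBody θ k Γ'.blank) T (Function.update T K.out2
      ((nodeOut θ k (T K.hdr2) []).reverse ++ T K.out2)) (7 * (T K.hdr2).length + 4) := by
  rw [nodeBody]
  have g := runs_emitLeaf T (hT _ (by decide) (by decide) (by decide))
  rw [hT K.acc (by decide) (by decide) (by decide)] at g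
  refine g.of_eq ?_ (by simp)
  rw [nodeOut, nodeLeaf, thetaL_nil, findBranch_nil]
  simp only [leafW, wFam_nil, List.append_nil]
  rw [← hT K.acc (by decide) (by decide) (by decide), Function.update_eq_self]

/-! ### The main loop: depth-first traversal driven by the work-list -/

/-- `mainLoop θ k`: process the top family of the work-list until it is empty.
[cite: ImpagliazzoPaturiZaneJCSS2001, §2 (Reduce)] -/
def mainLoop (θ : ℕ → ℕ) (k : ℕ) : Prog := loop K.wl (nodeBody θ k)

/-- The output of the traversal with `fuel` iterations from the work-list `Lw` (families are
processed depth-first: the children of a node replace it at the top). [folklore] -/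
def dfsOut (θ : ℕ → ℕ) (k : ℕ) (hd : List Γ') : ℕ → List (List (List Lit)) → List Γ'
  | 0, _ => []
  | _ + 1, [] => []
  | f + 1, F :: Lw => nodeOut θ k hd F ++ dfsOut θ k hd f (nodeKids θ k F ++ Lw)

/-- The traversal empties the work-list within `fuel` iterations. [folklore] -/
def DfsDone (θ : ℕ → ℕ) (k : ℕ) : ℕ → List (List (List Lit)) → Prop
  | _, [] => True
  | 0, _ :: _ => False
  | f + 1, F :: Lw => DfsDone θ k f (nodeKids θ k F ++ Lw)

/-- A node has at most two children. [folklore] -/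
theorem length_nodeKids_le (θ : ℕ → ℕ) (k : ℕ) (F : List (List Lit)) :
    (nodeKids θ k F).length ≤ 2 := by
  unfold nodeKids; split <;> simp

/-- Length of a work-list word. [folklore] -/
theorem length_wWL_le {Lw : List (List (List Lit))} {B : ℕ} (h : ∀ F ∈ Lw, (wFam F).length ≤ B) :
    (wWL Lw).length ≤ Lw.length * (B + 1) := by
  induction Lw with
  | nil => simp
  | cons F Lw ih =>
    have h1 := h F List.mem_cons_self
    have h2 := ih (fun G hG => h G (List.mem_cons_of_mem _ hG))
    rw [wWL_cons, List.length_append, List.length_cons, List.length_cons, Nat.succ_mul]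
    omega

/-- Monotonicity of the node cost in the family size and the work-list length. [folklore] -/
theorem cNode_mono (L kk th hdl : ℕ) {n n' w w' : ℕ} (hn : n ≤ n') (hw : w ≤ w') :
    cNode L kk n th hdl w ≤ cNode L kk n' th hdl w' := by
  unfold cNode cTheta cThAct cPass1 cPass2 cScan cLevel cProcS cTry cCount cKids cPetal cHeart
    cExtract
  gcongr

/-- **The main loop.** Let `Good` be a property of families that implies the size bounds and is
preserved from a node to its children. If the traversal from a work-list of good families
terminates within `fuel` iterations, `mainLoop` empties the work-list and appends the (reversed)
traversal output to `out2`, within `fuel` times a uniform node cost.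
[cite: ImpagliazzoPaturiZaneJCSS2001, §2 (Reduce)] -/
theorem runs_mainLoop (θ : ℕ → ℕ) (k : ℕ) (L kk th Nf : ℕ) (hk : k ≤ kk)
    (hth : ∀ i, i < k → θ i ≤ th) (Good : List (List Lit) → Prop)
    (hGb : ∀ F, Good F → (∀ c ∈ F, ∀ l ∈ c, (litBody l).length ≤ L) ∧ (∀ c ∈ F, c.length ≤ kk) ∧
      F.length ≤ Nf)
    (hGk : ∀ F, Good F → ∀ G ∈ nodeKids θ k F, Good G) (hd : List Γ') :
    ∀ (fuel : ℕ) (Lw : List (List (List Lit))) (D : ℕ) (T : Store), DfsDone θ k fuel Lw →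
      (∀ F ∈ Lw, Good F) → Lw.length ≤ D → Idle T → T K.wl = wWL Lw → T K.hdr2 = hd →
      Runs (mainLoop θ k) T (Function.update (Function.update T K.wl []) K.out2
        ((dfsOut θ k hd fuel Lw).reverse ++ T K.out2))
        (fuel * (cNode L kk Nf th hd.length ((D + fuel) * (((L + 1) * kk + 2) * Nf + 1)) + 2) + 1) := by
  set W := (L + 1) * kk with hW
  set C := fun fuel D => cNode L kk Nf th hd.length ((D + fuel) * ((W + 2) * Nf + 1)) with hC
  have hGW : ∀ F, Good F → (wFam F).length ≤ (W + 2) * Nf := by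
    intro F hF
    obtain ⟨h1, h2, h3⟩ := hGb F hF
    exact (length_wFam_le (fun c hc => (length_cbody_le (h1 c hc)).trans
      (by rw [hW]; exact Nat.mul_le_mul_left _ (h2 c hc)))).trans (Nat.mul_le_mul_left _ h3)
  intro fuel
  induction fuel with
  | zero =>
    intro Lw D T hdone hgood hD hI hwl hhd
    cases Lw with
    | cons F Lw => exact absurd hdone (by simp [DfsDone])
    | nil =>
      rw [wWL_nil] at hwl
      refine (Runs.loop_nil (nodeBody θ k) (R := T) hwl).of_eq ?_ (by simp)
      simp only [dfsOut, List.reverse_nil, List.nil_append]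
      rw [← hwl, Function.update_eq_self, Function.update_eq_self]
  | succ f ih =>
    intro Lw D T hdone hgood hD hI hwl hhd
    cases Lw with
    | nil =>
      rw [wWL_nil] at hwl
      refine (Runs.loop_nil (nodeBody θ k) (R := T) hwl).of_eq ?_ (by simp)
      simp only [dfsOut, List.reverse_nil, List.nil_append]
      rw [← hwl, Function.update_eq_self, Function.update_eq_self]
    | cons F Lw =>
      rw [DfsDone] at hdone
      have hF := hgood F List.mem_cons_self
      obtain ⟨hLF, hkF, hNF⟩ := hGb F hF
      have hgood' : ∀ G ∈ nodeKids θ k F ++ Lw, Good G := by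
        intro G hG
        rw [List.mem_append] at hG
        rcases hG with hG | hG
        · exact hGk F hF G hG
        · exact hgood G (List.mem_cons_of_mem _ hG)
      have hD' : (nodeKids θ k F ++ Lw).length ≤ D + 1 := by
        rw [List.length_append]
        have := length_nodeKids_le θ k F
        rw [List.length_cons] at hD
        omega
      have hwlen : (wWL Lw).length ≤ (D + (f + 1)) * ((W + 2) * Nf + 1) := by
        refine (length_wWL_le (fun G hG => hGW G (hgood G (List.mem_cons_of_mem _ hG)))).trans ?_
        exact Nat.mul_le_mul_right _ (by rw [List.length_cons] at hD; omega)
      rw [wWL_cons] at hwl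
      by_cases hFnil : F = []
      · -- an empty family: its word is empty, the first symbol is the closing blank
        subst hFnil
        rw [wFam_nil, List.nil_append] at hwl
        set T₀ := Function.update T K.wl (wWL Lw) with hT₀
        have hI₀ : Idle T₀ := hI.update (Or.inr (Or.inr rfl)) _
        have hbody := runs_nodeBody_nil θ k T₀ hI₀
        have hT₀hd : T₀ K.hdr2 = hd := by simp [hT₀, hhd]
        rw [hT₀hd] at hbody
        set T₁ := Function.update T₀ K.out2 ((nodeOut θ k hd []).reverse ++ T₀ K.out2) with hT₁
        have hI₁ : Idle T₁ := hI₀.update (Or.inl rfl) _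
        have hkids : nodeKids θ k [] = [] := by rw [nodeKids, thetaL_nil, findBranch_nil]
        rw [hkids, List.nil_append] at hdone hgood' hD'
        have hrest := ih Lw (D + 1) T₁ hdone hgood' hD' hI₁ (by simp [hT₁, hT₀]) (by simp [hT₁, hT₀, hhd])
        have := Runs.loop_cons hwl hbody hrest
        refine this.of_eq ?_ ?_
        · simp only [hT₁, hT₀, dfsOut, hkids, List.nil_append, List.reverse_append]
          funext r; cases r <;> simp
        · have h1 : 7 * hd.length + 4 ≤ C (f + 1) D := by
            simp only [hC, cNode]; omega
          simp only [hC] at h1 ⊢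
          rw [show D + 1 + f = D + (f + 1) by omega, Nat.succ_mul f]
          omega
      · -- a nonempty family: the first symbol is its opening bracket
        obtain ⟨c, F', hcF⟩ := List.exists_cons_of_ne_nil hFnil
        have hw : wFam F = Γ'.bra :: (wFam F).tail := by rw [hcF, wFam_cons]; rfl
        rw [hw, List.cons_append] at hwl
        set T₀ := Function.update T K.wl ((wFam F).tail ++ Γ'.blank :: wWL Lw) with hT₀
        have hI₀ : Idle T₀ := hI.update (Or.inr (Or.inr rfl)) _
        have hbody := runs_nodeBody_cons θ k F hFnil Lw L kk th hk hth hLF hkF T₀ hI₀ (by simp [hT₀])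
          Γ'.bra (by decide)
        have hT₀hd : T₀ K.hdr2 = hd := by simp [hT₀, hhd]
        rw [hT₀hd] at hbody
        set T₁ := Function.update (Function.update T₀ K.wl (wWL (nodeKids θ k F ++ Lw))) K.out2
          ((nodeOut θ k hd F).reverse ++ T₀ K.out2) with hT₁
        have hI₁ : Idle T₁ := (hI₀.update (Or.inr (Or.inr rfl)) _).update (Or.inl rfl) _
        have hrest := ih (nodeKids θ k F ++ Lw) (D + 1) T₁ hdone hgood' hD' hI₁ (by simp [hT₁])
          (by simp [hT₁, hT₀, hhd])
        have := Runs.loop_cons hwl hbody hrest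
        refine this.of_eq ?_ ?_
        · simp only [hT₁, hT₀, dfsOut, List.reverse_append]
          funext r; cases r <;> simp
        · have h1 : cNode L kk F.length th hd.length (wWL Lw).length ≤ C (f + 1) D :=
            cNode_mono L kk th hd.length hNF hwlen
          simp only [hC] at h1 ⊢
          rw [show D + 1 + f = D + (f + 1) by omega, Nat.succ_mul f]
          omega

/-! ### The whole program -/

/-- **The sparsification program**: read the header, normalise the clauses, and unless some
clause is empty run the traversal; finally put the output word on `out` and clear the header.
[cite: ImpagliazzoPaturiZaneJCSS2001, §2 (Reduce)] -/
def main (θ : ℕ → ℕ) (k : ℕ) : Prog :=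
  readHeader ;; normalize ;;
  ifTop K.kill (fun o => match o with
    | some _ => clear K.kill ;; clear K.wl
    | none => mainLoop θ k) ;;
  pour K.out2 K.out ;; clear K.hdr2

/-- The output word of the program on a k-CNF, according to the list model: nothing if some
clause is empty, otherwise the traversal output from the normalised root family. [folklore] -/
def progOut (θ : ℕ → ℕ) (k : ℕ) (fuel : ℕ) {k' : ℕ} (φ : KCNF k') : List Γ' :=
  if [] ∈ φ.clauses then [] else dfsOut θ k (hdrW φ.numVars) fuel [φ.clauses.map ddl]

/-- Cost of the whole program. [folklore] -/
def cMain (L kk th Nf m hdl fuel : ℕ) : ℕ :=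
  9 * L + 8 + cNorm L kk m + (2 * m + 2 * (((L + 1) * kk + 2) * m + 2) +
    (fuel * (cNode L kk Nf th hdl ((1 + fuel) * (((L + 1) * kk + 2) * Nf + 1)) + 2) + 1) + 5) +
    3 * (fuel * (hdl + ((L + 1) * kk + 2) * Nf + 1)) + 1 + 2 * hdl + 1

/-- The traversal output is not longer than `fuel` leaf encodings. [folklore] -/
theorem length_dfsOut_le (θ : ℕ → ℕ) (k : ℕ) (hd : List Γ') {B : ℕ} (Good : List (List Lit) → Prop)
    (hGk : ∀ F, Good F → ∀ G ∈ nodeKids θ k F, Good G)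
    (hB : ∀ F, Good F → (wFam (thetaL F)).length ≤ B) :
    ∀ (fuel : ℕ) (Lw : List (List (List Lit))), (∀ F ∈ Lw, Good F) →
      (dfsOut θ k hd fuel Lw).length ≤ fuel * (hd.length + B + 1)
  | 0, Lw, _ => by simp [dfsOut]
  | f + 1, [], _ => by simp [dfsOut]
  | f + 1, F :: Lw, hg => by
    have hF := hg F List.mem_cons_self
    have ih := length_dfsOut_le θ k hd Good hGk hB f (nodeKids θ k F ++ Lw) (by
      intro G hG; rw [List.mem_append] at hG
      rcases hG with hG | hG
      · exact hGk F hF G hG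
      · exact hg G (List.mem_cons_of_mem _ hG))
    have h1 : (nodeOut θ k hd F).length ≤ hd.length + B + 1 := by
      unfold nodeOut
      split
      · rename_i M hM
        have hM' : thetaL F = M := by
          unfold nodeLeaf at hM
          split at hM
          · simp at hM
          · simpa using hM
        subst hM'
        simp only [leafW, List.length_append, List.length_singleton]
        have := hB F hF; omega
      · simp
    rw [dfsOut, List.length_append, Nat.succ_mul]
    omega

/-- **Specification of the whole program.** On the encoding of `φ` in `inp` (all other registers
empty), if the traversal from the normalised root family terminates within `fuel` iterations
(with `Good` as in `runs_mainLoop`), the program ends with `progOut θ k fuel φ` in `out` and all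
other registers empty. [cite: ImpagliazzoPaturiZaneJCSS2001, §2 (Reduce)] -/
theorem runs_main (θ : ℕ → ℕ) (k : ℕ) {k' : ℕ} (φ : KCNF k') (L kk th Nf fuel : ℕ) (hk : k ≤ kk)
    (hth : ∀ i, i < k → θ i ≤ th) (hL : φ.encode.length ≤ L)
    (hLφ : ∀ c ∈ φ.clauses, ∀ l ∈ c, (litBody l).length ≤ L) (hkφ : ∀ c ∈ φ.clauses, c.length ≤ kk)
    (Good : List (List Lit) → Prop)
    (hGb : ∀ F, Good F → (∀ c ∈ F, ∀ l ∈ c, (litBody l).length ≤ L) ∧ (∀ c ∈ F, c.length ≤ kk) ∧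
      F.length ≤ Nf)
    (hGk : ∀ F, Good F → ∀ G ∈ nodeKids θ k F, Good G) (hG0 : Good (φ.clauses.map ddl))
    (hdone : [] ∉ φ.clauses → DfsDone θ k fuel [φ.clauses.map ddl]) :
    Runs (main θ k) (AStore.single K.inp φ.encode) (AStore.single K.out (progOut θ k fuel φ))
      (cMain L kk th Nf φ.clauses.length (hdrW φ.numVars).length fuel) := by
  unfold main
  set W := (L + 1) * kk with hW
  set T : Store := AStore.single K.inp φ.encode with hT
  have hTz : ∀ r, r ≠ K.inp → T r = [] := fun r h => AStore.single_of_ne h _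
  -- the header
  have e1 := runs_readHeader φ.numVars (wFam φ.clauses) T (by rw [hT, AStore.single_self]; rfl)
    (hTz _ (by decide)) (hTz _ (by decide)) (hTz _ (by decide)) (hTz _ (by decide))
  rw [show T K.inp = φ.encode from AStore.single_self _ _] at e1
  set T₁ := Function.update (Function.update (Function.update T K.inp []) K.raw (wFam φ.clauses))
    K.hdr2 (hdrW φ.numVars) with hT₁
  have hT₁z : ∀ r, r ≠ K.raw → r ≠ K.hdr2 → T₁ r = [] := by
    intro r h1 h2
    rcases eq_or_ne r K.inp with rfl | h0
    · simp [hT₁]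
    · simp only [hT₁]; rw [Function.update_of_ne h2, Function.update_of_ne h1,
        Function.update_of_ne h0]; exact hTz r h0
  -- the normalisation
  have e2 := runs_normalize φ.clauses L kk hLφ hkφ T₁ (by simp [hT₁]) (hT₁z _ (by decide) (by decide))
    (hT₁z _ (by decide) (by decide)) (hT₁z _ (by decide) (by decide)) (hT₁z _ (by decide) (by decide))
    (hT₁z _ (by decide) (by decide)) (hT₁z _ (by decide) (by decide))
    ⟨hT₁z _ (by decide) (by decide), hT₁z _ (by decide) (by decide), hT₁z _ (by decide) (by decide),
      hT₁z _ (by decide) (by decide), hT₁z _ (by decide) (by decide), hT₁z _ (by decide) (by decide),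
      hT₁z _ (by decide) (by decide), hT₁z _ (by decide) (by decide)⟩
  set T₂ := Function.update (Function.update (Function.update T₁ K.raw []) K.kill
    (unary (φ.clauses.count []))) K.wl (wWL [φ.clauses.map ddl]) with hT₂
  have hT₂z : ∀ r, r ≠ K.hdr2 → r ≠ K.kill → r ≠ K.wl → T₂ r = [] := by
    intro r h1 h2 h3
    rcases eq_or_ne r K.raw with rfl | h0
    · simp [hT₂]
    · simp only [hT₂]; rw [Function.update_of_ne h3, Function.update_of_ne h2,
        Function.update_of_ne h0]; exact hT₁z r h0 h1
  have hT₂hd : T₂ K.hdr2 = hdrW φ.numVars := by simp [hT₂, hT₁]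
  -- the traversal, or nothing
  set T₃ : Store := Function.update (Function.update (Function.update T₂ K.kill []) K.wl []) K.out2
    (progOut θ k fuel φ).reverse with hT₃
  have e3 : Runs (ifTop K.kill fun o => match o with
      | some _ => clear K.kill ;; clear K.wl
      | none => mainLoop θ k) T₂ T₃
      (2 * φ.clauses.length + 2 * ((W + 2) * φ.clauses.length + 2) +
        (fuel * (cNode L kk Nf th (hdrW φ.numVars).length ((1 + fuel) * ((W + 2) * Nf + 1)) + 2) + 1) + 5) := by
    by_cases hemp : [] ∈ φ.clauses
    · have hcnt : 0 < φ.clauses.count [] := List.count_pos_iff.2 hemp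
      obtain ⟨e, he⟩ : ∃ e, φ.clauses.count [] = e + 1 := ⟨_, (Nat.succ_pred_eq_of_pos hcnt).symm⟩
      have hk' : T₂ K.kill = Γ'.blank :: unary e := by simp [hT₂, he, unary_succ]
      have g1 := runs_clear K.kill T₂
      rw [hk', List.length_cons, length_unary] at g1
      have g2 := runs_clear K.wl (Function.update T₂ K.kill [])
      have hv : Function.update T₂ K.kill [] K.wl = wWL [φ.clauses.map ddl] := by simp [hT₂]
      rw [hv] at g2
      have hwlen : (wWL [φ.clauses.map ddl]).length ≤ (W + 2) * φ.clauses.length + 1 := by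
        rw [wWL_cons, wWL_nil, List.length_append, List.length_singleton]
        have h := length_wFam_le (F := φ.clauses.map ddl) (W := W) (by
          intro c hc
          obtain ⟨c', hc', rfl⟩ := List.mem_map.1 hc
          exact (length_cbody_le_of_sublist (ddlAux_sublist c' [])).trans
            ((length_cbody_le (hLφ c' hc')).trans (by rw [hW]; exact Nat.mul_le_mul_left _ (hkφ c' hc'))))
        rw [List.length_map] at h; omega
      have hecnt : e + 1 ≤ φ.clauses.length := he ▸ List.count_le_length
      refine (Runs.ifTop_cons hk' ((g1.seq g2).of_eq ?_ le_rfl)).mono (by nlinarith)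
      rw [hT₃, progOut, if_pos hemp, List.reverse_nil]
      symm
      refine Function.update_eq_self_iff.2 ?_
      rw [Function.update_of_ne (show K.out2 ≠ K.wl by decide),
        Function.update_of_ne (show K.out2 ≠ K.kill by decide)]
      exact (hT₂z K.out2 (by decide) (by decide) (by decide)).symm
    · have hk' : T₂ K.kill = [] := by
        simp [hT₂, List.count_eq_zero.2 hemp]
      have hI : Idle T₂ := fun r h1 h2 h3 => by
        rcases eq_or_ne r K.kill with rfl | h4
        · exact hk'
        · exact hT₂z r h2 h4 h3
      have g := runs_mainLoop θ k L kk th Nf hk hth Good hGb hGk (hdrW φ.numVars) fuel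
        [φ.clauses.map ddl] 1 T₂ (hdone hemp) (by simpa using hG0) (by simp) hI (by simp [hT₂]) hT₂hd
      rw [← hW] at g
      refine (Runs.ifTop_nil hk' (g.of_eq ?_ le_rfl)).mono (by omega)
      rw [hT₃, progOut, if_neg hemp, hT₂z K.out2 (by decide) (by decide) (by decide), List.append_nil,
        (Function.update_eq_self_iff (f := T₂) (a := K.kill) (b := [])).2 hk'.symm]
  -- the output in reading order, the header cleared
  have e4 := runs_pour (a := K.out2) (b := K.out) (by decide) T₃
  have hT₃out2 : T₃ K.out2 = (progOut θ k fuel φ).reverse := by simp [hT₃]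
  have hT₃out : T₃ K.out = [] := by
    simp only [hT₃]; rw [Function.update_of_ne (by decide), Function.update_of_ne (by decide),
      Function.update_of_ne (by decide)]; exact hT₂z _ (by decide) (by decide) (by decide)
  rw [hT₃out2, hT₃out, List.length_reverse, List.reverse_reverse, List.append_nil] at e4
  set T₄ := Function.update (Function.update T₃ K.out2 []) K.out (progOut θ k fuel φ) with hT₄
  have e5 := runs_clear K.hdr2 T₄
  have hT₄hd : T₄ K.hdr2 = hdrW φ.numVars := by simp [hT₄, hT₃, hT₂hd]
  rw [hT₄hd] at e5
  have := e1.seq (e2.seq (e3.seq (e4.seq e5)))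
  refine this.of_eq ?_ ?_
  · rw [hT₄, hT₃, hT₂, hT₁, hT]
    funext r; cases r <;> simp [AStore.single]
  · have hout : (progOut θ k fuel φ).length ≤
        fuel * ((hdrW φ.numVars).length + (W + 2) * Nf + 1) := by
      unfold progOut
      split
      · simp
      · refine length_dfsOut_le θ k _ Good hGk (fun F hF => ?_) fuel _ (by simpa using hG0)
        obtain ⟨h1, h2, h3⟩ := hGb F hF
        have hM : ∀ c ∈ thetaL F, c ∈ F := fun c hc => mem_of_mem_thetaL hc
        refine (length_wFam_le (W := W) (fun c hc => (length_cbody_le (h1 c (hM c hc))).trans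
          (by rw [hW]; exact Nat.mul_le_mul_left _ (h2 c (hM c hc))))).trans ?_
        refine Nat.mul_le_mul_left _ ((?_ : (thetaL F).length ≤ F.length).trans h3)
        have := length_foldl_thetaStep_le F []; simpa [thetaL] using this
    simp only [cMain, ← hW]
    omega

end Literature.Computability.FineGrained.Sparsifier
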